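import Literature.AlgebraicGeometry.AbelianSchemes.PolarizedTripleRigidityOfFiniteType
import Literature.AlgebraicGeometry.AbelianVarieties.HomogeneousDivisorClassTransfer
import Literature.AlgebraicGeometry.Motives.AbelianVarietyAutBaseChangeTransfer
import HarnessLib

/-!
# TRIPLES ARE RIGID over EVERY locally Noetherian ℚ-scheme — the (L3) assembly: the field brick of the lemma of Serre for an
# arbitrary algebraically closed field of characteristic `0`, by descent to a countable algebraically closed subfield and
# ascent to `ℂ` ([Deligne1971TravauxShimura] 4.16; [MumfordFogartyKirwan1994] p. 139; [Milne1986AbelianVarieties] Prop. 17.5)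

Layer `Literature/AlgebraicGeometry/AbelianSchemes`, namespace `Literature.AlgebraicGeometry.AbelianSchemes.PolarizedAbelianSchemeWithLevel`
(§A in `Literature.AlgebraicGeometry.Motives.AbelianVariety`).  Cell hodgecm-mathlib, F-DAG leaf F-7 (7b) / F-8 (8e), layer (L3),
file F4 (seat B-p03 (g17)); (F)'s `classify` ranges over ALL locally Noetherian ℚ-schemes (director s220), so the field brick is needed
for residue fields of any cardinality.  §A = the ASCENT half (the brick over any countable algebraically closed field of characteristic
`0`, from the brick over `ℂ` ★ `HodgeTheory.AbelianVarietyPolarizedAutomorphismRigidity`, via ★ F3 `HomogeneousDivisorClassTransfer` and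
★ `Motives.AbelianVarietyAutBaseChangeTransfer`); §C = the scheme-level capstone over ★ `rigid_of_forall_abelianVariety` + ★
`eq_id_and_hat_eq_id_of_forall_geometricPoint`, from the brick at every algebraically closed field of characteristic `0`; §B-core = the
DESCENT THROUGH A MODEL with one tower step (the brick over `Ω` from a model `(B₁, e₁, Θ₁)` over `k₁ ⊆ k₂ ⊆ Ω` whose divisor is ample over
the countable algebraically closed `k₂`; ★ F3, ★ `baseChangeTowerIso`, ★ `Motives.AbelianVarietyAutBaseChangeTransfer`, §A).  The
finite-generation inputs of §B — the model (★ F1 `Motives.AbelianVarietyFGSubfieldDescentDivisor`, B-p12 (g15)) and ampleness at a finitely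
generated stage (F2 `Motives.CartierDivisorAmpleSpread`) — discharge §C's hypothesis in the sequel edition.

HC_CM is proved only modulo the 7 printed citations until rung 0 closes; this file discharges none of them.

## References
* [Deligne1971TravauxShimura] P. Deligne, Travaux de Shimura, Sém. Bourbaki 389 (1971), 4.16 (p. 150).
* [MumfordFogartyKirwan1994] D. Mumford, J. Fogarty, F. Kirwan, *Geometric Invariant Theory*, 3rd ed. (1994), Ch. 7 §3, remark after
  Thm. 7.9 (p. 139).
* [Milne1986AbelianVarieties] J. S. Milne, Abelian varieties, in Cornell–Silverman (1986), Prop. 17.5 (p. 139).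
* [MumfordAV1970] D. Mumford, *Abelian Varieties* (1970), §8.
-/

set_option autoImplicit false

noncomputable section

open CategoryTheory CategoryTheory.Limits AlgebraicGeometry

namespace Literature.AlgebraicGeometry.Motives

namespace AbelianVariety

open Literature.AlgebraicGeometry.AbelianVarieties Literature.AlgebraicGeometry.AbelianVarieties.AbelianVariety

/-! ### §A ASCENT: the field brick over a countable algebraically closed field of characteristic `0` from the brick over `ℂ` -/

/-- **The field brick of the lemma of Serre ASCENDS from a countable algebraically closed field `k` of characteristic `0`**:
embed `σ : k ↪ ℂ` (★ `nonempty_ringHom_complex_of_countable`), base-change `(B, e, Θ)` along `σ` (`Θ ⊗ ℂ` is ample, ★ `IsAmple.pullback`;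
the Pic⁰ clause ascends from the algebraically closed `k`, ★ `forall_linEquiv_translation_ascent_along`; the torsion clause ascends,
★ `forall_torsion_map_baseChange_eq`; the brick over `ℂ` ★ `HodgeTheory.AbelianVariety.forall_iso_hom_eq_id_of_three_le`), and come
back by faithfulness of base change (★ `eq_id_of_baseChange_eq_id`; both transfer bricks from `Motives/AbelianVarietyAutBaseChangeTransfer`,
cell hodgecm-mathlib (L3), B-p13 (g19)). [cite: Milne1986AbelianVarieties, Prop. 17.5 (b) (p. 139)]
[cite: MumfordFogartyKirwan1994, Ch. 7 §3, remark after Theorem 7.9 (p. 139)] [cite: MumfordAV1970, §8 (pp. 74–75)] -/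
theorem iso_hom_eq_id_of_countable {k : Type} [Field k] [IsAlgClosed k] [CharZero k] [Countable k] {N : ℕ} (hN : 3 ≤ N)
    (B : AbelianVariety k) (e : B ≅ B) (Θ : CartierDivisor B.X.left) (hΘ : Θ.IsAmple)
    (hNS : haveI := isDominant_toSchemeHom_iso_hom e
      ∀ Q : B.Points k, ((Θ + -Θ.pullback (Hom.toSchemeHom e.hom)).pullback (B.translation Q).left).LinEquiv
        (Θ + -Θ.pullback (Hom.toSchemeHom e.hom)))
    (htor : ∀ P : B.Points k, P ^ N = 1 → AlgPoints.map e.hom.hom.hom.hom P = P) : e.hom = 𝟙 B := by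
  haveI := isDominant_toSchemeHom_iso_hom e
  -- embed `k ↪ ℂ` and base-change along it
  obtain ⟨σ⟩ := Literature.FieldTheory.AlgClosed.nonempty_ringHom_complex_of_countable k
  let B' : AbelianVariety ℂ := B.baseChangeAlong σ
  let e' : B' ≅ B' := (baseChangeFunctor k (AlongHom ℂ σ)).mapIso e
  haveI := isDominant_toSchemeHom_iso_hom e'
  let π : B'.X.left ⟶ B.X.left := baseChangeHomFst σ B.X
  have hπ : π = baseChangeHomFst σ B.X := rfl
  haveI : IsDominant π := isDominant_of_eq_baseChangeHomFst B σ π hπ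
  haveI : IsAffineHom π := MorphismProperty.pullback_fst _ _ inferInstance
  -- `Θ ⊗ ℂ` is ample
  let Θ' : CartierDivisor B'.X.left := Θ.pullback π
  have hΘ' : Θ'.IsAmple := hΘ.pullback π
  -- the Pic⁰ clause ascends, then is moved to `Θ' − e'^*Θ'`
  have hsq : Hom.toSchemeHom e'.hom ≫ π = π ≫ Hom.toSchemeHom e.hom :=
    toSchemeHom_baseChange_comp_fst (AlongHom ℂ σ) e.hom
  have hNS₁ := forall_linEquiv_translation_ascent_along B (Θ + -Θ.pullback (Hom.toSchemeHom e.hom)) σ π hπ hNS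
  haveI : IsDominant (Hom.toSchemeHom e'.hom ≫ π) := inferInstance
  haveI : IsDominant (π ≫ Hom.toSchemeHom e.hom) := inferInstance
  have hlin : ((Θ + -Θ.pullback (Hom.toSchemeHom e.hom)).pullback π).LinEquiv (Θ' + -Θ'.pullback (Hom.toSchemeHom e'.hom)) := by
    have h1 : ((Θ + -Θ.pullback (Hom.toSchemeHom e.hom)).pullback π).SameDivisor
        (Θ.pullback π + (-Θ.pullback (Hom.toSchemeHom e.hom)).pullback π) :=
      CartierDivisor.pullback_add_sameDivisor Θ (-Θ.pullback (Hom.toSchemeHom e.hom)) π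
    have h2 : ((-Θ.pullback (Hom.toSchemeHom e.hom)).pullback π).SameDivisor (-((Θ.pullback (Hom.toSchemeHom e.hom)).pullback π)) :=
      CartierDivisor.pullback_neg_sameDivisor π _
    have h3 : ((Θ.pullback (Hom.toSchemeHom e.hom)).pullback π).SameDivisor (Θ'.pullback (Hom.toSchemeHom e'.hom)) :=
      ((CartierDivisor.pullback_pullback_sameDivisor Θ (Hom.toSchemeHom e.hom) π).trans
        (CartierDivisor.pullback_congr_sameDivisor Θ hsq.symm)).trans
        (CartierDivisor.pullback_pullback_sameDivisor Θ π (Hom.toSchemeHom e'.hom)).symm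
    exact (h1.trans (CartierDivisor.SameDivisor.add (CartierDivisor.SameDivisor.refl _) (h2.trans h3.neg))).linEquiv
  have hNS' := forall_linEquiv_translation_of_linEquiv hlin hNS₁
  -- the torsion clause ascends (★ B-p13 at `L := AlongHom ℂ σ`)
  haveI : IsAlgClosed (AlongHom ℂ σ) := inferInstanceAs (IsAlgClosed ℂ)
  have hNk : (N : k) ≠ 0 := by
    have : (0 : ℕ) < N := lt_of_lt_of_le (by norm_num) hN
    exact_mod_cast this.ne'
  have htor' : ∀ P : B'.Points ℂ, P ^ N = 1 → AlgPoints.map e'.hom.hom.hom.hom P = P :=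
    forall_torsion_map_baseChange_eq (AlongHom ℂ σ) e.hom hNk htor
  -- the brick over `ℂ`
  have h' : e'.hom = 𝟙 B' :=
    Literature.AlgebraicGeometry.HodgeTheory.AbelianVariety.forall_iso_hom_eq_id_of_three_le hN B' e' Θ' hΘ' hNS' htor'
  -- back along `σ` (faithfulness of base change, ★ B-p13)
  exact eq_id_of_baseChange_eq_id (AlongHom ℂ σ) e.hom h'

/-! ### §B-core: through a descent datum and one tower step (no finite-generation bookkeeping here) -/

/-- **The field brick DESCENDS THROUGH A MODEL**: let `Ω ⊇ k₂ ⊇ k₁` be a tower of fields with `k₂` countable, algebraically closed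
of characteristic `0` and `Ω` algebraically closed; let `(B, e, Θ)` over `Ω` carry the Pic⁰ clause for `Θ − e^*Θ` and the torsion
clause; let `(B₁, e₁, Θ₁)` over `k₁` be a MODEL — `ε : B₁ ⊗ Ω ≅ B` with `(e₁ ⊗ Ω) ≫ ε = ε ≫ e` and `ε^*Θ ∼ Θ₁ ⊗ Ω` — whose
divisor becomes AMPLE over `k₂`.  Then `e = 𝟙`.  (Move both clauses to `B₁ ⊗ Ω` along `ε` (★ F3 `forall_linEquiv_translation_pullback_iso`,
★ `forall_torsion_map_eq_iff_of_conj`), across the tower isomorphism `(B₁ ⊗ k₂) ⊗ Ω ≅ B₁ ⊗ Ω` (★ `baseChangeTowerIso` with ★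
`toSchemeHom_baseChangeTowerIso_hom_comp_fst`, ★ `Hom.baseChange_baseChange_comp_baseChangeTowerIso_hom`), DOWN to `k₂` (★ F3
`forall_linEquiv_translation_descent_along`, ★ `forall_torsion_map_eq_of_baseChange`), apply §A at `k₂`, and return through ★
`baseChange_eq_id_iff_of_conj` twice.)  The finite-generation inputs — the model (★ F1 `exists_finset_intermediateField_descent_end_divisor`,
B-p12 (g15)) and the ampleness at a finitely generated stage (F2 `CartierDivisorAmpleSpread`) — are supplied by the sequel.
[cite: Milne1986AbelianVarieties, Prop. 17.5 (b) (p. 139)] [cite: MumfordAV1970, §8 (pp. 74–75) and §4] -/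
theorem iso_hom_eq_id_of_model {k₁ k₂ Ω : Type} [Field k₁] [Field k₂] [Field Ω] [Algebra k₁ k₂] [Algebra k₂ Ω] [Algebra k₁ Ω]
    [IsScalarTower k₁ k₂ Ω] [IsAlgClosed k₂] [CharZero k₂] [Countable k₂] [IsAlgClosed Ω] {N : ℕ} (hN : 3 ≤ N)
    {B : AbelianVariety Ω} (e : B ≅ B) (Θ : CartierDivisor B.X.left)
    (hNS : haveI := isDominant_toSchemeHom_iso_hom e
      ∀ Q : B.Points Ω, ((Θ + -Θ.pullback (Hom.toSchemeHom e.hom)).pullback (B.translation Q).left).LinEquiv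
        (Θ + -Θ.pullback (Hom.toSchemeHom e.hom)))
    (htor : ∀ P : B.Points Ω, P ^ N = 1 → AlgPoints.map e.hom.hom.hom.hom P = P)
    {B₁ : AbelianVariety k₁} (ε : B₁.baseChange Ω ≅ B) (e₁ : B₁ ≅ B₁)
    (hconj : Hom.baseChange Ω e₁.hom ≫ ε.hom = ε.hom ≫ e.hom) (Θ₁ : CartierDivisor B₁.X.left)
    (pr₁Ω : (B₁.baseChange Ω).X.left ⟶ B₁.X.left) (hpr₁Ω : pr₁Ω = pullback.fst B₁.X.hom (bcSpec k₁ Ω)) [IsDominant pr₁Ω]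
    (pr₁₂ : (B₁.baseChange k₂).X.left ⟶ B₁.X.left) (hpr₁₂ : pr₁₂ = pullback.fst B₁.X.hom (bcSpec k₁ k₂)) [IsDominant pr₁₂]
    [IsDominant (Hom.toSchemeHom ε.hom)]
    (hΘ₁ : (Θ.pullback (Hom.toSchemeHom ε.hom)).LinEquiv (Θ₁.pullback pr₁Ω)) (hΘ₂ : (Θ₁.pullback pr₁₂).IsAmple) :
    e.hom = 𝟙 B := by
  haveI := isDominant_toSchemeHom_iso_hom e
  haveI := isDominant_toSchemeHom_iso_hom e₁
  let B₂ : AbelianVariety k₂ := B₁.baseChange k₂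
  let e₂ : B₂ ≅ B₂ := (baseChangeFunctor k₁ k₂).mapIso e₁
  haveI := isDominant_toSchemeHom_iso_hom e₂
  let pr₂Ω : (B₂.baseChange Ω).X.left ⟶ B₂.X.left := pullback.fst B₂.X.hom (bcSpec k₂ Ω)
  have hpr₂Ω : pr₂Ω = baseChangeHomFst (algebraMap k₂ Ω) B₂.X := rfl
  have hdom₂ : IsDominant pr₂Ω := by
    rw [hpr₂Ω]; exact isDominant_baseChangeHomFst_along (algebraMap k₂ Ω) B₂
  haveI := hdom₂
  let τ : B₂.baseChange Ω ≅ B₁.baseChange Ω := baseChangeTowerIso k₁ k₂ Ω B₁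
  haveI := isDominant_toSchemeHom_iso_hom τ
  let eΩ : B₁.baseChange Ω ≅ B₁.baseChange Ω := (baseChangeFunctor k₁ Ω).mapIso e₁
  haveI := isDominant_toSchemeHom_iso_hom eΩ
  let Θ₂ : CartierDivisor B₂.X.left := Θ₁.pullback pr₁₂
  -- scheme-level squares
  have sqΩ : Hom.toSchemeHom eΩ.hom ≫ pr₁Ω = pr₁Ω ≫ Hom.toSchemeHom e₁.hom := by
    rw [hpr₁Ω]; exact toSchemeHom_baseChange_comp_fst Ω e₁.hom
  have sq₁₂ : Hom.toSchemeHom e₂.hom ≫ pr₁₂ = pr₁₂ ≫ Hom.toSchemeHom e₁.hom := by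
    rw [hpr₁₂]; exact toSchemeHom_baseChange_comp_fst k₂ e₁.hom
  have sqτ : Hom.toSchemeHom τ.hom ≫ pr₁Ω = pr₂Ω ≫ pr₁₂ := by
    rw [hpr₁Ω, hpr₁₂]; exact toSchemeHom_baseChangeTowerIso_hom_comp_fst k₁ k₂ Ω B₁
  have sqε : Hom.toSchemeHom eΩ.hom ≫ Hom.toSchemeHom ε.hom = Hom.toSchemeHom ε.hom ≫ Hom.toSchemeHom e.hom :=
    congrArg Hom.toSchemeHom hconj
  -- §1 the Pic⁰ clause on `B₁ ⊗ Ω` for `ε^*(Θ − e^*Θ)`, then for `(Θ₁ − e₁^*Θ₁) ⊗ Ω`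
  have hNS₁ := forall_linEquiv_translation_pullback_iso ε (Θ + -Θ.pullback (Hom.toSchemeHom e.hom)) hNS
  have hlin₁ : ((Θ + -Θ.pullback (Hom.toSchemeHom e.hom)).pullback (Hom.toSchemeHom ε.hom)).LinEquiv
      ((Θ₁ + -Θ₁.pullback (Hom.toSchemeHom e₁.hom)).pullback pr₁Ω) := by
    haveI : IsDominant (Hom.toSchemeHom ε.hom ≫ Hom.toSchemeHom e.hom) := inferInstance
    haveI : IsDominant (Hom.toSchemeHom eΩ.hom ≫ Hom.toSchemeHom ε.hom) := inferInstance
    haveI : IsDominant (Hom.toSchemeHom eΩ.hom ≫ pr₁Ω) := inferInstance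
    haveI : IsDominant (pr₁Ω ≫ Hom.toSchemeHom e₁.hom) := inferInstance
    -- `ε^*(e^*Θ) ∼ pr^*(e₁^*Θ₁)`
    have hA : ((Θ.pullback (Hom.toSchemeHom e.hom)).pullback (Hom.toSchemeHom ε.hom)).LinEquiv
        ((Θ₁.pullback (Hom.toSchemeHom e₁.hom)).pullback pr₁Ω) := by
      have h1 : ((Θ.pullback (Hom.toSchemeHom e.hom)).pullback (Hom.toSchemeHom ε.hom)).SameDivisor
          ((Θ.pullback (Hom.toSchemeHom ε.hom)).pullback (Hom.toSchemeHom eΩ.hom)) :=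
        ((CartierDivisor.pullback_pullback_sameDivisor Θ (Hom.toSchemeHom e.hom) (Hom.toSchemeHom ε.hom)).trans
          (CartierDivisor.pullback_congr_sameDivisor Θ sqε.symm)).trans
          (CartierDivisor.pullback_pullback_sameDivisor Θ (Hom.toSchemeHom ε.hom) (Hom.toSchemeHom eΩ.hom)).symm
      have h2 : ((Θ.pullback (Hom.toSchemeHom ε.hom)).pullback (Hom.toSchemeHom eΩ.hom)).LinEquiv
          ((Θ₁.pullback pr₁Ω).pullback (Hom.toSchemeHom eΩ.hom)) := hΘ₁.pullback _
      have h3 : ((Θ₁.pullback pr₁Ω).pullback (Hom.toSchemeHom eΩ.hom)).SameDivisor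
          ((Θ₁.pullback (Hom.toSchemeHom e₁.hom)).pullback pr₁Ω) :=
        ((CartierDivisor.pullback_pullback_sameDivisor Θ₁ pr₁Ω (Hom.toSchemeHom eΩ.hom)).trans
          (CartierDivisor.pullback_congr_sameDivisor Θ₁ sqΩ)).trans
          (CartierDivisor.pullback_pullback_sameDivisor Θ₁ (Hom.toSchemeHom e₁.hom) pr₁Ω).symm
      exact (h1.linEquiv.trans h2).trans h3.linEquiv
    have hL : ((Θ + -Θ.pullback (Hom.toSchemeHom e.hom)).pullback (Hom.toSchemeHom ε.hom)).SameDivisor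
        (Θ.pullback (Hom.toSchemeHom ε.hom) + -((Θ.pullback (Hom.toSchemeHom e.hom)).pullback (Hom.toSchemeHom ε.hom))) :=
      (CartierDivisor.pullback_add_sameDivisor Θ (-Θ.pullback (Hom.toSchemeHom e.hom)) (Hom.toSchemeHom ε.hom)).trans
        (CartierDivisor.SameDivisor.add (CartierDivisor.SameDivisor.refl _) (CartierDivisor.pullback_neg_sameDivisor _ _))
    have hR : ((Θ₁ + -Θ₁.pullback (Hom.toSchemeHom e₁.hom)).pullback pr₁Ω).SameDivisor
        (Θ₁.pullback pr₁Ω + -((Θ₁.pullback (Hom.toSchemeHom e₁.hom)).pullback pr₁Ω)) :=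
      (CartierDivisor.pullback_add_sameDivisor Θ₁ (-Θ₁.pullback (Hom.toSchemeHom e₁.hom)) pr₁Ω).trans
        (CartierDivisor.SameDivisor.add (CartierDivisor.SameDivisor.refl _) (CartierDivisor.pullback_neg_sameDivisor _ _))
    exact (hL.linEquiv.trans (CartierDivisor.LinEquiv.add hΘ₁ hA.neg)).trans hR.linEquiv.symm
  have hNS₂ := forall_linEquiv_translation_of_linEquiv hlin₁ hNS₁
  -- §2 across the tower: the clause on `B₂ ⊗ Ω` for `(Θ₂ − e₂^*Θ₂) ⊗ Ω`
  have hNS₃ := forall_linEquiv_translation_pullback_iso τ ((Θ₁ + -Θ₁.pullback (Hom.toSchemeHom e₁.hom)).pullback pr₁Ω) hNS₂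
  have hlin₂ : (((Θ₁ + -Θ₁.pullback (Hom.toSchemeHom e₁.hom)).pullback pr₁Ω).pullback (Hom.toSchemeHom τ.hom)).LinEquiv
      ((Θ₂ + -Θ₂.pullback (Hom.toSchemeHom e₂.hom)).pullback pr₂Ω) := by
    haveI : IsDominant (Hom.toSchemeHom τ.hom ≫ pr₁Ω) := inferInstance
    haveI : IsDominant (pr₂Ω ≫ pr₁₂) := inferInstance
    haveI : IsDominant (Hom.toSchemeHom e₂.hom ≫ pr₁₂) := inferInstance
    haveI : IsDominant (pr₁₂ ≫ Hom.toSchemeHom e₁.hom) := inferInstance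
    have h1 : (((Θ₁ + -Θ₁.pullback (Hom.toSchemeHom e₁.hom)).pullback pr₁Ω).pullback (Hom.toSchemeHom τ.hom)).SameDivisor
        (((Θ₁ + -Θ₁.pullback (Hom.toSchemeHom e₁.hom)).pullback pr₁₂).pullback pr₂Ω) :=
      ((CartierDivisor.pullback_pullback_sameDivisor _ pr₁Ω (Hom.toSchemeHom τ.hom)).trans
        (CartierDivisor.pullback_congr_sameDivisor _ sqτ)).trans
        (CartierDivisor.pullback_pullback_sameDivisor _ pr₁₂ pr₂Ω).symm
    have h2 : ((Θ₁ + -Θ₁.pullback (Hom.toSchemeHom e₁.hom)).pullback pr₁₂).SameDivisor (Θ₂ + -Θ₂.pullback (Hom.toSchemeHom e₂.hom)) := by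
      have h3 : ((Θ₁.pullback (Hom.toSchemeHom e₁.hom)).pullback pr₁₂).SameDivisor (Θ₂.pullback (Hom.toSchemeHom e₂.hom)) :=
        ((CartierDivisor.pullback_pullback_sameDivisor Θ₁ (Hom.toSchemeHom e₁.hom) pr₁₂).trans
          (CartierDivisor.pullback_congr_sameDivisor Θ₁ sq₁₂.symm)).trans
          (CartierDivisor.pullback_pullback_sameDivisor Θ₁ pr₁₂ (Hom.toSchemeHom e₂.hom)).symm
      exact (CartierDivisor.pullback_add_sameDivisor Θ₁ (-Θ₁.pullback (Hom.toSchemeHom e₁.hom)) pr₁₂).trans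
        (CartierDivisor.SameDivisor.add (CartierDivisor.SameDivisor.refl _)
          ((CartierDivisor.pullback_neg_sameDivisor _ _).trans h3.neg))
    exact h1.linEquiv.trans ((h2.pullback pr₂Ω).linEquiv)
  have hNS₄ := forall_linEquiv_translation_of_linEquiv hlin₂ hNS₃
  -- §3 DOWN to `k₂`
  have hNS₅ : ∀ Q : B₂.Points k₂, ((Θ₂ + -Θ₂.pullback (Hom.toSchemeHom e₂.hom)).pullback (B₂.translation Q).left).LinEquiv
      (Θ₂ + -Θ₂.pullback (Hom.toSchemeHom e₂.hom)) :=
    @forall_linEquiv_translation_descent_along k₂ _ B₂ (Θ₂ + -Θ₂.pullback (Hom.toSchemeHom e₂.hom)) Ω _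
      (algebraMap k₂ Ω) pr₂Ω hpr₂Ω hdom₂ hNS₄
  -- §4 the torsion clause: to `B₁ ⊗ Ω`, across the tower, down to `k₂`
  have htor₁ : ∀ P : (B₁.baseChange Ω).Points Ω, P ^ N = 1 → AlgPoints.map (Hom.baseChange Ω e₁.hom).hom.hom.hom P = P :=
    (forall_torsion_map_eq_iff_of_conj ε e₁.hom e.hom hconj).1 htor
  have hnat : Hom.baseChange Ω (Hom.baseChange k₂ e₁.hom) ≫ τ.hom = τ.hom ≫ Hom.baseChange Ω e₁.hom :=
    Hom.baseChange_baseChange_comp_baseChangeTowerIso_hom k₂ Ω e₁.hom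
  have htor₂ : ∀ P : (B₂.baseChange Ω).Points Ω, P ^ N = 1 →
      AlgPoints.map (Hom.baseChange Ω (Hom.baseChange k₂ e₁.hom)).hom.hom.hom P = P :=
    (forall_torsion_map_eq_iff_of_conj τ (Hom.baseChange k₂ e₁.hom) (Hom.baseChange Ω e₁.hom) hnat).1 htor₁
  have htor₃ : ∀ Q : B₂.Points k₂, Q ^ N = 1 → AlgPoints.map e₂.hom.hom.hom.hom Q = Q :=
    forall_torsion_map_eq_of_baseChange Ω (Hom.baseChange k₂ e₁.hom) htor₂
  -- §5 the brick at the countable algebraically closed `k₂` (§A)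
  have h₂ : e₂.hom = 𝟙 B₂ := iso_hom_eq_id_of_countable hN B₂ e₂ Θ₂ hΘ₂ hNS₅ htor₃
  -- §6 back up the tower and through `ε`
  have hΩ : Hom.baseChange Ω e₁.hom = 𝟙 _ := by
    refine (baseChange_eq_id_iff_of_conj τ (Hom.baseChange k₂ e₁.hom) (Hom.baseChange Ω e₁.hom) hnat).1 ?_
    change Hom.baseChange Ω e₂.hom = 𝟙 _
    rw [h₂, Hom.baseChange_id]
  exact (baseChange_eq_id_iff_of_conj ε e₁.hom e.hom hconj).1 hΩ

end AbelianVariety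

end Literature.AlgebraicGeometry.Motives

namespace Literature.AlgebraicGeometry.AbelianSchemes

namespace PolarizedAbelianSchemeWithLevel

open Literature.AlgebraicGeometry.Motives

variable {g N : ℕ} {δ : Fin g → ℕ}

/-! ### §C The scheme-level capstone from the field brick at every algebraically closed field of characteristic `0` -/

/-- A field receiving a morphism `Spec Ω → Spec ℚ` has characteristic `0` (the ring map `ℚ → Ω` behind it is injective). [folklore] -/
private theorem charZero_of_hom_specRat {Ω : Type} [Field Ω] (t : Spec (.of Ω) ⟶ Spec (.of ℚ)) : CharZero Ω :=
  (RingHom.charZero_iff (Spec.preimage t).hom.injective).mp inferInstance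

/-- **TRIPLES ARE RIGID OVER EVERY LOCALLY NOETHERIAN ℚ-SCHEME, given the field brick of the lemma of Serre at every algebraically
closed field of characteristic `0`** ([Deligne1971TravauxShimura] 4.16 «pour `n ≥ 3` les objets classifiés n'ont plus d'automorphismes»,
in the generality of (F)'s `classify`): ★ `eq_id_and_hat_eq_id_of_forall_geometricPoint` (any locally Noetherian base, all geometric points)
fed with ★ `rigid_of_forall_abelianVariety` (the brick at `Ω` ⇒ triples over `Spec Ω` rigid); the brick itself is §A (ascent from a
countable algebraically closed subfield) after §B (descent to one).  [cite: Deligne1971TravauxShimura, 4.16 p. 150]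
[cite: MumfordFogartyKirwan1994, Ch. 7 §3, remark after Theorem 7.9 (p. 139)] [cite: Milne1986AbelianVarieties, Prop. 17.5 (p. 139)] -/
theorem eq_id_and_hat_eq_id_of_over_rat {S : Scheme.{0}} [IsLocallyNoetherian S] (f : S ⟶ Spec (.of ℚ))
    (P : PolarizedAbelianSchemeWithLevel g N δ S)
    (FB : ∀ (Ω : Type) [Field Ω] [IsAlgClosed Ω] [CharZero Ω] (B : AbelianVariety Ω) (e : B ≅ B)
      (Θ : CartierDivisor B.X.left), Θ.IsAmple →
      (haveI := AbelianVariety.isDominant_toSchemeHom_iso_hom e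
       ∀ Q : B.Points Ω, ((Θ + -Θ.pullback (AbelianVariety.Hom.toSchemeHom e.hom)).pullback
          (B.translation Q).left).LinEquiv (Θ + -Θ.pullback (AbelianVariety.Hom.toSchemeHom e.hom))) →
      (∀ P : B.Points Ω, P ^ N = 1 → AlgPoints.map e.hom.hom.hom.hom P = P) → e.hom = 𝟙 B)
    {G : P.A.X.left ⟶ P.A.X.left} {Ĝ : P.D.hat.X.left ⟶ P.D.hat.X.left} (h : P.IsBaseChangeVia P (𝟙 S) G Ĝ) :
    G = 𝟙 P.A.X.left ∧ Ĝ = 𝟙 P.D.hat.X.left :=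
  P.eq_id_and_hat_eq_id_of_forall_geometricPoint
    (fun Ω _ _ t Q _ _ hQ => by
      haveI : CharZero Ω := charZero_of_hom_specRat (t ≫ f)
      exact rigid_of_forall_abelianVariety (FB Ω) Q hQ) h

/-- **… hence pull-back data of triples are UNIQUE over every locally Noetherian ℚ-scheme** (the isomorphisms of `classify` are
unique; local isomorphisms glue — [MumfordFogartyKirwan1994] Prop. 7.6), given the field brick.
[cite: MumfordFogartyKirwan1994, Ch. 7 §2 Proposition 7.6 (pp. 136–138); §3, remark after Theorem 7.9 (p. 139)]
[cite: Deligne1971TravauxShimura, 4.16 p. 150] -/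
theorem IsBaseChangeVia.unique_of_over_rat {S T : Scheme.{0}} [IsLocallyNoetherian T] (fT : T ⟶ Spec (.of ℚ))
    {P : PolarizedAbelianSchemeWithLevel g N δ S} {P' : PolarizedAbelianSchemeWithLevel g N δ T}
    (FB : ∀ (Ω : Type) [Field Ω] [IsAlgClosed Ω] [CharZero Ω] (B : AbelianVariety Ω) (e : B ≅ B)
      (Θ : CartierDivisor B.X.left), Θ.IsAmple →
      (haveI := AbelianVariety.isDominant_toSchemeHom_iso_hom e
       ∀ Q : B.Points Ω, ((Θ + -Θ.pullback (AbelianVariety.Hom.toSchemeHom e.hom)).pullback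
          (B.translation Q).left).LinEquiv (Θ + -Θ.pullback (AbelianVariety.Hom.toSchemeHom e.hom))) →
      (∀ P : B.Points Ω, P ^ N = 1 → AlgPoints.map e.hom.hom.hom.hom P = P) → e.hom = 𝟙 B)
    {f : T ⟶ S} {G₁ G₂ : P'.A.X.left ⟶ P.A.X.left} {Ĝ₁ Ĝ₂ : P'.D.hat.X.left ⟶ P.D.hat.X.left}
    (h₁ : P'.IsBaseChangeVia P f G₁ Ĝ₁) (h₂ : P'.IsBaseChangeVia P f G₂ Ĝ₂) : G₁ = G₂ ∧ Ĝ₁ = Ĝ₂ := by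
  obtain ⟨K, Kd, -, -, hKG, hKdG, hK⟩ := h₁.exists_isBaseChangeVia_id_of_isBaseChangeVia h₂
  obtain ⟨hK1, hKd1⟩ := eq_id_and_hat_eq_id_of_over_rat fT P' FB hK
  rw [hK1, Category.id_comp] at hKG
  rw [hKd1, Category.id_comp] at hKdG
  exact ⟨hKG, hKdG⟩

end PolarizedAbelianSchemeWithLevel

end Literature.AlgebraicGeometry.AbelianSchemes

end
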